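/-
Copyright: the b2b-balaban cell (near-miss cell 7), T⁴-continuum fan-out; row NE7b ROUND-2 swarm, seat
t4-ne7b-formalise-leaf-10 (gen 3; sub-row S6g′(f) of `t4/b2b-balaban-t4-ne7b-p1/LEAVES-NE7b.md`, owner's ruling
R-OWNER-22-12 (2)).  Released under the licence of the surrounding project.
-/
import Summits.QuantumFields.BalabanUV.T4Continuum.Support.HistorySiblingEntropyBridge
import Summits.QuantumFields.BalabanUV.T4Continuum.Support.HistoryJoinsEntropyBudget
import Summits.QuantumFields.BalabanUV.T4Continuum.Support.HistoryZoneMassDating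

/-!
# Sibling entropy bound, the BRIDGE (part 2 of 2): the budget and the entropy in the binding's letters, and the
# DISCHARGE `E ≤ 2·bsum (1 + fat) + 2·partnerAges + 4·NH` (row S6g′(f))

Summits-side support leaf of the T⁴-continuum cell (rung (B)+1 on a FINITE torus only; NOT infinite volume, NOT the
mass gap, NOT the Clay statement; NOT a proof of the spine estimate NE7b).  Row NE7b, route «COUNT», row S6g′
«MASS-BASED SIBLING COUNT» (R-OWNER-22-12 (2)); sequel of `HistorySiblingEntropyBridge`.  [folklore] well-founded
recursion over the lineage's own carrier and finite sums; nothing is quoted from print, nothing printed is asserted, no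
`[cite:]` tag, no `Prop` fact minted.

WHAT.  `sum_parts_eq`; **`phi_toShape`** (`Φ(toShape G) = bsum (1 + fat) G + AG G`); `count_map_of_nodup`; the class
bookkeeping `csize_eq_zero_of_not_rep`, `key_eq_of_part_eq`, **`lmult_eq_logMultinomial_csize`** (under «equal shapes ⇒
equal parts» at a join, the log-multinomial of the non-host shape list IS `logMultinomial univ csize` — the join's
entropy in leaf-05 gen 2's letters); **`ent_toShape`** (`ent (toShape G) = E G` ⇐ `InjParts`); **`AG_le`**
(`AG ≤ partnerAges + 2·NH`, by the tournament identity `HistoryJoins.partnerAges_add_eq_sum_clusterParts`); and the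
END **`E_le`**: `Mono st G → ShapeSorted st fat G → InjParts st fat G →
E st G ≤ 2·bsum (1 + fat) G + 2·partnerAges st G + 4·NH st G` (`HistorySiblingEntropyBound.ent_le_two_mul_phi` through
the bridge) — CLASS-LINEAR with absolute constants: the typer's display `hent` (ACCEPT-A12I v1.5 (3),
`Σ_{q ∈ croots} logMultinomial … ≤ θ_e·bsum (fat+1) + λ_e·partnerAges + A_e·gsize`) holds with `θ_e = λ_e = 2`,
`A_e = 4` (per non-host part; `NH ≤` number of merge nodes) for every member whose encoding satisfies the three displays.

HONEST SCOPE.  The displays `Mono`∕`ShapeSorted`∕`InjParts` are encoding facts for leaf-08∕leaf-09's `toPGen`∕`genT`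
(chronology with births read by node step and renewals strictly later; shape-first chain order — the convention of
journal l.9428∕l.9699; canonical labels∕renewals∕bracketing), displayed here, not derived.  Nothing of H3∕(B)∕BetaPertH
is touched.  NE7b NOT proved.  HONEST DEPENDENCY (cell): continuum YM on T⁴ ⇐ BetaPertH ∧ nine spine estimates (0/9
proved); BetaPertH ⇐ (D1) ∧ (D4) ∧ CAP+tail; G-an2-4 gates asym, D1 and NE2/3/4.  This file changes none of it.
-/

open Finset
open Literature.MathematicalPhysics.QuantumFieldTheory.Balaban1983to89
open T4PersistenceDictionary T4PartnerMultiplicity T4BranchingRecordsGas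
open Summit.QuantumFields.BalabanUV.T4Continuum.HistoryJoins
open Summit.QuantumFields.BalabanUV.T4Continuum.HistoryJoinsAdm
open Summit.QuantumFields.BalabanUV.T4Continuum.HistoryJoinsClass
open Summit.QuantumFields.BalabanUV.T4Continuum.HistorySiblingEntropy
open Summit.QuantumFields.BalabanUV.T4Continuum.HistorySiblingEntropyBound
open Summit.QuantumFields.BalabanUV.T4Continuum.HistoryJoinsBudget (mrg)
open Summit.QuantumFields.BalabanUV.T4Continuum.HistoryJoinsEntropyBudget (ent ENT)
open Summit.QuantumFields.BalabanUV.T4Continuum.HistoryZoneMassDating (RenewStrict)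

namespace Summit.QuantumFields.BalabanUV.T4Continuum.HistorySiblingEntropyBridge

noncomputable section

open scoped Classical

variable {ε : Type*} (st : ε → ℕ) (fat : ε → ℕ)

/-! ## §2 (continued) The budget and the entropy in the binding's letters -/

/-- a sum over the part indices is the sum over the part list [folklore] -/
theorem sum_parts_eq {M : Type*} [AddCommMonoid M] (G : Gen ε) (g : List Bool × Gen ε → M) :
    ∑ i, g (part st G i) = ((jparts st G).map g).sum := by
  simp only [part]
  rw [← List.sum_ofFn]
  congr 1
  exact List.ofFn_getElem_eq_map (jparts st G) g

/-- **THE BUDGET OF THE SHAPE**: `Φ(toShape G) = bsum (1 + fat) G + AG G`. [folklore] -/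
theorem phi_toShape : ∀ G : Gen ε, ((toShape st fat G).phi : ℝ) = bsum (fun b => (1 : ℝ) + fat b) G + (AG st G : ℝ)
  | Gen.born b j => by rw [toShape_born, AG]; simp [Shape.phi, bsum]
  | Gen.renew G e h => by rw [toShape_renew, AG, phi_toShape G]; rfl
  | Gen.merge X Y e => by
      rw [toShape_merge, AG]
      simp only [Shape.phi, Nat.cast_add, Nat.cast_sum]
      rw [Parts.phi_cast, toList_ofList, List.map_map]
      -- births: over all parts
      have hb : bsum (fun b => (1 : ℝ) + fat b) (Gen.merge X Y e) =
          ∑ i, bsum (fun b => (1 : ℝ) + fat b) (part st (Gen.merge X Y e) i).2 := by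
        rw [sum_parts_eq st _ (fun q => bsum (fun b => (1 : ℝ) + fat b) q.2), bsum_eq_sum_clusterParts st _ (st e)]
        rfl
      -- the non-host list sum as a finset sum
      have hl : ((nonhost st X Y e).map ((fun x : Shape => (x.phi : ℝ) + ((st e + 1 + 1 - x.root : ℕ) : ℝ) + 1) ∘
            fun i => toShape st fat (part st (Gen.merge X Y e) i).2)).sum =
          ∑ i ∈ univ.filter (fun i => i ≠ hostIdx st X Y e),
            (((toShape st fat (part st (Gen.merge X Y e) i).2).phi : ℝ) +
              ((st e + 1 + 1 - (part st (Gen.merge X Y e) i).2.rootStep : ℕ) : ℝ) + 1) := by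
        rw [sum_nonhost]
        refine sum_congr rfl fun i _ => ?_
        simp only [Function.comp, toShape_root]
      rw [hl, hb]
      -- parts: inductive hypothesis
      have ih : ∀ i, ((toShape st fat (part st (Gen.merge X Y e) i).2).phi : ℝ) =
          bsum (fun b => (1 : ℝ) + fat b) (part st (Gen.merge X Y e) i).2 + (AG st (part st (Gen.merge X Y e) i).2 : ℝ) :=
        fun i => phi_toShape (part st (Gen.merge X Y e) i).2
      rw [sum_congr rfl fun i _ => by rw [ih i]]
      rw [ih]
      -- split the host off the two full sums
      have hsplit : ∀ f : Fin (npart st (Gen.merge X Y e)) → ℝ,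
          ∑ i, f i = f (hostIdx st X Y e) + ∑ i ∈ univ.filter (fun i => i ≠ hostIdx st X Y e), f i := by
        intro f
        rw [← Finset.add_sum_erase univ f (mem_univ (hostIdx st X Y e)), filter_ne']
      rw [hsplit (fun i => bsum (fun b => (1 : ℝ) + fat b) (part st (Gen.merge X Y e) i).2),
        hsplit (fun i => (AG st (part st (Gen.merge X Y e) i).2 : ℝ))]
      push_cast
      simp only [sum_add_distrib]
      ring
termination_by G => gsize G
decreasing_by
  all_goals first
    | (simp only [gsize]; omega)
    | exact gsize_lt_of_mem_jparts st _ _ (part_mem st _ _)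


/-! ### The entropy of the shape is the entropy in the binding's letters -/

/-- counting the values of a map over a duplicate-free list [folklore] -/
theorem count_map_of_nodup {α β : Type*} [DecidableEq α] [DecidableEq β] (φ : α → β) (y : β) :
    ∀ l : List α, l.Nodup → (l.map φ).count y = (l.toFinset.filter fun i => φ i = y).card
  | [], _ => by simp
  | a :: l, hl => by
      rw [List.nodup_cons] at hl
      rw [List.map_cons, List.count_cons, count_map_of_nodup φ y l hl.2, List.toFinset_cons, filter_insert]
      by_cases ha : φ a = y
      · rw [if_pos ha, card_insert_of_notMem (fun hm => hl.1 (List.mem_toFinset.1 (mem_filter.1 hm).1))]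
        simp [ha]
      · rw [if_neg ha]; simp [ha]

section Classes

variable {st fat} {X Y : Gen ε} {e : ε}

/-- a class with a member is represented by its key [folklore] -/
theorem csize_eq_zero_of_not_rep {j : Fin (npart st (Gen.merge X Y e))} (hj : key st X Y e j ≠ some j) :
    csize st X Y e j = 0 := by
  unfold csize
  rw [card_eq_zero, filter_eq_empty_iff]
  intro i _ hi
  exact hj (key_rep hi)

/-- equal non-host parts have equal keys [folklore] -/
theorem key_eq_of_part_eq {i i' : Fin (npart st (Gen.merge X Y e))} (hi : i ≠ hostIdx st X Y e)
    (hi' : i' ≠ hostIdx st X Y e) (h : (part st _ i).2 = (part st _ i').2) : key st X Y e i = key st X Y e i' := by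
  unfold key
  rw [dif_neg hi, dif_neg hi']
  congr 2
  ext j; simp [h]

/-- **THE JOIN'S ENTROPY IN BOTH LETTERS**: under «equal shapes are equal parts» at this join, the log-multinomial of the
non-host shape list equals `logMultinomial univ csize`. [folklore] -/
theorem lmult_eq_logMultinomial_csize
    (hinj : ∀ i j, i ≠ hostIdx st X Y e → j ≠ hostIdx st X Y e →
      toShape st fat (part st (Gen.merge X Y e) i).2 = toShape st fat (part st (Gen.merge X Y e) j).2 →
        (part st (Gen.merge X Y e) i).2 = (part st (Gen.merge X Y e) j).2) :
    (ofList ((nonhost st X Y e).map fun i => toShape st fat (part st (Gen.merge X Y e) i).2)).lmult =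
      logMultinomial univ (csize st X Y e) := by
  set h := hostIdx st X Y e with hh
  set φ : Fin (npart st (Gen.merge X Y e)) → Shape := fun i => toShape st fat (part st (Gen.merge X Y e) i).2 with hφ
  set L := (nonhost st X Y e).map φ with hL
  set reps : Finset (Fin (npart st (Gen.merge X Y e))) := univ.filter fun j => key st X Y e j = some j with hreps
  have hrep_ne : ∀ j ∈ reps, j ≠ h := by
    intro j hj
    rw [hreps, mem_filter] at hj
    exact (key_ne_none_iff j).1 (by rw [hj.2]; simp)
  -- counts of representatives
  have hcount : ∀ j ∈ reps, L.count (φ j) = csize st X Y e j := by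
    intro j hj
    have hjh := hrep_ne j hj
    rw [hreps, mem_filter] at hj
    rw [hL, count_map_of_nodup φ (φ j) _ (nodup_nonhost st X Y e), toFinset_nonhost, filter_filter]
    unfold csize
    congr 1
    ext i
    simp only [mem_filter, mem_univ, true_and]
    constructor
    · rintro ⟨hih, hφi⟩
      have hp := hinj i j hih hjh hφi
      rw [key_eq_of_part_eq hih hjh hp, hj.2]
    · intro hk
      refine ⟨(key_ne_none_iff i).1 (by rw [hk]; simp), ?_⟩
      simp only [hφ, part_eq_of_key_eq_some hk]
  -- the shape set is the image of the representatives
  have himage : L.toFinset = reps.image φ := by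
    ext x
    rw [hL, List.mem_toFinset, List.mem_map, mem_image]
    constructor
    · rintro ⟨i, hi, rfl⟩
      have hih : i ≠ h := (mem_nonhost st).1 hi
      obtain ⟨j, hj⟩ := Option.ne_none_iff_exists'.1 ((key_ne_none_iff i).2 hih)
      refine ⟨j, by rw [hreps, mem_filter]; exact ⟨mem_univ _, key_rep hj⟩, ?_⟩
      simp only [hφ, part_eq_of_key_eq_some hj]
    · rintro ⟨j, hj, rfl⟩
      exact ⟨j, (mem_nonhost st).2 (hrep_ne j hj), rfl⟩
  have hinjφ : Set.InjOn φ (reps : Set (Fin (npart st (Gen.merge X Y e)))) := by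
    intro j hj j' hj' hjj
    have hjr := hj; have hjr' := hj'
    rw [mem_coe, hreps, mem_filter] at hjr hjr'
    have hp := hinj j j' (hrep_ne j hj) (hrep_ne j' hj') hjj
    have hk := key_eq_of_part_eq (hrep_ne j hj) (hrep_ne j' hj') hp
    rw [hjr.2, hjr'.2] at hk
    exact Option.some_injective _ hk
  -- lengths
  have hlen : L.length = npart st (Gen.merge X Y e) - 1 := by
    rw [hL, List.length_map, ← List.toFinset_card_of_nodup (nodup_nonhost st X Y e), toFinset_nonhost, filter_ne',
      card_erase_of_mem (mem_univ _), card_univ, Fintype.card_fin]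
  -- assemble
  unfold Parts.lmult logMultinomial
  rw [toList_ofList, List.sum_toFinset_count_eq_length, hlen, sum_csize]
  congr 1
  rw [himage, sum_image hinjφ]
  symm
  rw [← sum_subset (subset_univ reps) fun j _ hj => by
    rw [csize_eq_zero_of_not_rep (fun hk => hj (by rw [hreps, mem_filter]; exact ⟨mem_univ _, hk⟩))]; simp]
  exact sum_congr rfl fun j hj => by beta_reduce; rw [hcount j hj]

end Classes

/-- **THE ENTROPY OF THE SHAPE** from the displayed injectivity: `ent (toShape G) = E G`. [folklore] -/
theorem ent_toShape : ∀ G : Gen ε, InjParts st fat G → (toShape st fat G).ent = E st G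
  | Gen.born b j, _ => by rw [toShape_born, E]; simp [Shape.ent]
  | Gen.renew G e h, hi => by
      rw [toShape_renew, E]; rw [InjParts] at hi; exact ent_toShape G hi
  | Gen.merge X Y e, hi => by
      rw [InjParts] at hi
      rw [toShape_merge, E]
      simp only [Shape.ent]
      rw [Parts.entSum_eq_sum, toList_ofList, List.map_map, lmult_eq_logMultinomial_csize hi.2]
      have hl : ((nonhost st X Y e).map (Shape.ent ∘ fun i => toShape st fat (part st (Gen.merge X Y e) i).2)).sum =
          ∑ i ∈ univ.filter (fun i => i ≠ hostIdx st X Y e), E st (part st (Gen.merge X Y e) i).2 := by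
        rw [sum_nonhost]
        exact sum_congr rfl fun i _ => ent_toShape _ (hi.1 i)
      rw [hl, ent_toShape _ (hi.1 _), ← Finset.add_sum_erase univ (fun i => E st (part st (Gen.merge X Y e) i).2)
        (mem_univ (hostIdx st X Y e)), filter_ne']
termination_by G => gsize G
decreasing_by
  all_goals first
    | (simp only [gsize]; omega)
    | exact gsize_lt_of_mem_jparts st _ _ (part_mem st _ _)

/-! ### The budget in the binding's letters -/

/-- **THE SHIFTED AGES AGAINST THE PARTNER AGES** (tournament identity): `AG G ≤ partnerAges G + 2·NH G`. [folklore] -/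
theorem AG_le : ∀ G : Gen ε, AG st G ≤ partnerAges st G + 2 * NH st G
  | Gen.born b j => by rw [AG]; simp
  | Gen.renew G e h => by rw [AG, NH, partnerAges_renew]; exact AG_le G
  | Gen.merge X Y e => by
      rw [AG, NH]
      -- the tournament identity over the parts
      have ht := partnerAges_add_eq_sum_clusterParts st (st e) (Gen.merge X Y e)
      rw [← show jparts st (Gen.merge X Y e) = clusterParts st (st e) (Gen.merge X Y e) from rfl,
        ← sum_parts_eq st _ (fun q => partnerAges st q.2 + (st e + 1 - q.2.rootStep))] at ht
      -- split the host off
      have hsplit : ∀ f : Fin (npart st (Gen.merge X Y e)) → ℕ,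
          ∑ i, f i = f (hostIdx st X Y e) + ∑ i ∈ univ.filter (fun i => i ≠ hostIdx st X Y e), f i := by
        intro f
        rw [← Finset.add_sum_erase univ f (mem_univ (hostIdx st X Y e)), filter_ne']
      rw [hsplit] at ht
      rw [← rootStep_eq_host] at ht
      have ih : ∀ i, AG st (part st (Gen.merge X Y e) i).2 ≤
          partnerAges st (part st (Gen.merge X Y e) i).2 + 2 * NH st (part st (Gen.merge X Y e) i).2 :=
        fun i => AG_le (part st (Gen.merge X Y e) i).2
      have hcard : (univ.filter fun i => i ≠ hostIdx st X Y e).card = npart st (Gen.merge X Y e) - 1 := by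
        rw [filter_ne', card_erase_of_mem (mem_univ _), card_univ, Fintype.card_fin]
      have h1 : ∑ i, AG st (part st (Gen.merge X Y e) i).2 ≤
          ∑ i, (partnerAges st (part st (Gen.merge X Y e) i).2 + 2 * NH st (part st (Gen.merge X Y e) i).2) :=
        sum_le_sum fun i _ => ih i
      have h2 : ∑ i ∈ univ.filter (fun i => i ≠ hostIdx st X Y e),
            ((st e + 1 + 1 - (part st (Gen.merge X Y e) i).2.rootStep) + 1) ≤
          ∑ i ∈ univ.filter (fun i => i ≠ hostIdx st X Y e), (st e + 1 - (part st (Gen.merge X Y e) i).2.rootStep) +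
            2 * (npart st (Gen.merge X Y e) - 1) := by
        calc ∑ i ∈ univ.filter (fun i => i ≠ hostIdx st X Y e),
              ((st e + 1 + 1 - (part st (Gen.merge X Y e) i).2.rootStep) + 1)
            ≤ ∑ i ∈ univ.filter (fun i => i ≠ hostIdx st X Y e),
                ((st e + 1 - (part st (Gen.merge X Y e) i).2.rootStep) + 2) := sum_le_sum fun i _ => by omega
          _ = ∑ i ∈ univ.filter (fun i => i ≠ hostIdx st X Y e), (st e + 1 - (part st (Gen.merge X Y e) i).2.rootStep) +
                2 * (npart st (Gen.merge X Y e) - 1) := by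
              rw [sum_add_distrib, sum_const, hcard, smul_eq_mul, mul_comm]
      rw [sum_add_distrib, ← mul_sum] at h1
      rw [hsplit (fun i => partnerAges st (part st (Gen.merge X Y e) i).2)] at h1
      rw [sum_add_distrib] at ht
      omega
termination_by G => gsize G
decreasing_by
  all_goals first
    | (simp only [gsize]; omega)
    | exact gsize_lt_of_mem_jparts st _ _ (part_mem st _ _)

/-! ## §3 The discharge -/

/-- **THE SIBLING ENTROPY OF A CANONICALLY ENCODED MEMBER IS CLASS-LINEAR**:
`E G ≤ 2·bsum (1 + fat) G + 2·partnerAges G + 4·NH G` under the three displayed encoding predicates. [folklore] -/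
theorem E_le (G : Gen ε) (hm : Mono st G) (hs : ShapeSorted st fat G) (hi : InjParts st fat G) :
    E st G ≤ 2 * bsum (fun b => (1 : ℝ) + fat b) G + 2 * (partnerAges st G : ℝ) + 4 * (NH st G : ℝ) := by
  have h := ent_le_two_mul_phi (toShape st fat G) (wf_toShape st fat G hm) (canon_toShape st fat G hs)
  rw [ent_toShape st fat G hi, phi_toShape st fat G] at h
  have hAG : (AG st G : ℝ) ≤ (partnerAges st G : ℝ) + 2 * (NH st G : ℝ) := by exact_mod_cast AG_le st G
  linarith

/-! ### In leaf-05 gen 2's letters (`HistoryJoinsEntropyBudget.ENT`, `HistoryJoinsBudget.mrg`) -/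

/-- `E` is the binding's `ENT` (same recursion, the join's entropy added on the other side) [folklore] -/
theorem E_eq_ENT : ∀ G : Gen ε, E st G = ENT st G
  | Gen.born b j => by rw [E, ENT]
  | Gen.renew G e h => by rw [E, ENT]; exact E_eq_ENT G
  | Gen.merge X Y e => by
      rw [E, ENT, ent, add_comm]
      exact congrArg₂ _ rfl (sum_congr rfl fun i _ => E_eq_ENT (part st (Gen.merge X Y e) i).2)
termination_by G => gsize G
decreasing_by
  all_goals first
    | (simp only [gsize]; omega)
    | exact gsize_lt_of_mem_jparts st _ _ (part_mem st _ _)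

/-- `NH` is the binding's `mrg` (the number of non-host parts over all joins) [folklore] -/
theorem NH_cast_eq_mrg : ∀ G : Gen ε, (NH st G : ℝ) = mrg st G
  | Gen.born b j => by rw [NH, mrg]; simp
  | Gen.renew G e h => by rw [NH, mrg]; exact NH_cast_eq_mrg G
  | Gen.merge X Y e => by
      rw [NH, mrg]
      have hn : 1 ≤ npart st (Gen.merge X Y e) := by
        have := one_le_length_clusterParts st (st e) (Gen.merge X Y e)
        simpa [npart, jparts] using this
      push_cast [Nat.cast_sub hn]
      rw [add_comm, sum_congr rfl fun i _ => NH_cast_eq_mrg (part st (Gen.merge X Y e) i).2]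
termination_by G => gsize G
decreasing_by
  all_goals first
    | (simp only [gsize]; omega)
    | exact gsize_lt_of_mem_jparts st _ _ (part_mem st _ _)

/-- **THE DISCHARGE IN THE BINDING'S LETTERS**: for a canonically encoded member,
`ENT st G ≤ 2·bsum (1 + fat) G + 2·partnerAges st G + 4·mrg st G` — so `HistoryJoinsEntropyBudget.budgetE` is
class-linear: `≤ exp(6·mrg + MS + 2·bsum (1+fat) + 2·partnerAges)·NZP`. [folklore] -/
theorem ENT_le (G : Gen ε) (hm : Mono st G) (hs : ShapeSorted st fat G) (hi : InjParts st fat G) :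
    ENT st G ≤ 2 * bsum (fun b => (1 : ℝ) + fat b) G + 2 * (partnerAges st G : ℝ) + 4 * mrg st G := by
  rw [← E_eq_ENT, ← NH_cast_eq_mrg]
  exact E_le st fat G hm hs hi

/-! ### The first display from the canonical chronology -/

/-- births carry their step: `st b = j` at every birth node (true for `Pedigree.genT` by construction) [folklore] -/
def BirthStep : Gen ε → Prop
  | Gen.born b j => st b = j
  | Gen.renew G _ _ => BirthStep G
  | Gen.merge X Y _ => BirthStep X ∧ BirthStep Y

/-- under `BirthStep` the top step is at most the latest event step [folklore] -/
theorem top_le_maxStep : ∀ {G : Gen ε}, BirthStep st G → top st G ≤ T4CanonicalMenus.maxStep st G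
  | Gen.born b j, h => by simp only [top, T4CanonicalMenus.maxStep]; exact le_of_eq (by simpa [BirthStep] using h.symm)
  | Gen.renew G e hh, _ => by simp [top, T4CanonicalMenus.maxStep]
  | Gen.merge X Y e, _ => by simp [top, T4CanonicalMenus.maxStep]

/-- **`Mono` FROM THE CANONICAL CHRONOLOGY**: `BirthStep`, `T4CanonicalMenus.Chrono` and leaf-02 gen 3's `RenewStrict`
(free on pedigrees: `HistoryZoneMassDatingGen.renewStrict_genT`) give the first display. [folklore] -/
theorem mono_of_chrono : ∀ {G : Gen ε}, BirthStep st G → T4CanonicalMenus.Chrono st G → RenewStrict st G → Mono st G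
  | Gen.born _ _, _, _, _ => trivial
  | Gen.renew G e h, hb, hc, hr => by
      simp only [BirthStep] at hb
      simp only [T4CanonicalMenus.Chrono] at hc
      rw [HistoryZoneMassDating.renewStrict_renew] at hr
      exact ⟨mono_of_chrono hb hc.1 hr.1, (top_le_maxStep st hb).trans_lt hr.2⟩
  | Gen.merge X Y e, hb, hc, hr => by
      simp only [BirthStep] at hb
      simp only [T4CanonicalMenus.Chrono] at hc
      rw [HistoryZoneMassDating.renewStrict_merge] at hr
      exact ⟨mono_of_chrono hb.1 hc.1 hr.1, mono_of_chrono hb.2 hc.2.1 hr.2,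
        (top_le_maxStep st hb.1).trans hc.2.2.2.2.1, (top_le_maxStep st hb.2).trans hc.2.2.2.2.2⟩

end

/-! ## §4 Sanity -/

namespace Sanity

/-- the entropy functional vanishes on a bare birth and passes through renewals -/
example (st : ℕ → ℕ) (b j e h : ℕ) : E st (Gen.renew (Gen.born b j) e h) = 0 := by
  rw [E, E]

/-- the bridge shape of a bare birth is the atom (root step, fatness) -/
example : toShape (fun n : ℕ => n) (fun n => n + 7) (Gen.born 3 5) = Shape.atom 5 10 := by
  rw [toShape_born]

end Sanity

end Summit.QuantumFields.BalabanUV.T4Continuum.HistorySiblingEntropyBridge
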